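import Summits.ValiantsHypothesis.ValiantsHypothesis.Theorems.MonotoneRestorationOrbitRestorationQPFibreSigns
import HarnessLib

/-!
# Sign multiplicativity on invariant pieces of the factor multiset (ORBIT currency, ΠΣ sub-rung: plan item L6 tools)

Route MonotoneRestoration, crux `OrbitRestorationQP` (stmt-ValiantsHypothesis-18293), line `depth-three-rung`,
stub A₁ `stub_piSigmaValue`, namespace `Summit.ValiantsHypothesis.ValiantsHypothesis.Theorems.PieceSigns`.

The parity verification of rule M2′ (evidence `A1-M2PRIME-PROOF.md` on the crux item, §3) is organised around
PIECES `S = {ℓ ∈ L : P ℓ}` of the factor multiset cut out by a unit-invariant predicate `P` that is invariant under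
the pure row transposition `ρ = vact rowHom (x y)`, the pure column transposition `κ = vact colHom (x y)` and hence
the diagonal one `δ = ren (x y) = ρκ`.  On such a piece all three involutions act up to units, and the sign count turns
`δ = ρκ` into a parity identity.  This file provides the two generic tools (the fibre case is
`FibreSigns.even_diag_iff_even_row_add_col`):

* `map_mk_map_filter_eq_of_invariant` — if `θ·L ~ L` (same associates), `P` respects associates and `P (θ ℓ) ↔ P ℓ`,
  then `θ·S ~ S` for the piece `S = {ℓ ∈ L : P ℓ}`;
* **`even_diag_iff_even_row_add_col`** — for any multiset `S` of nonzero polynomials mapped to itself up to units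
  by `ρ`, `κ` and `δ`: `#{ℓ ∈ S : δℓ = -ℓ} ≡ #{ℓ ∈ S : ρℓ = -ℓ} + #{ℓ ∈ S : κℓ = -ℓ} (mod 2)`;
* `even_diag_piece` — the two combined for a piece of the factor multiset of a matrix-symmetric affine product.

Everything is proved. [folklore]

## References
* A. Dawar, G. Wilsenach, *Symmetric arithmetic circuits*, ToC 21 (2025), §3.3, Def. 6.1. [DawarWilsenach2025]
-/

noncomputable section

open scoped Classical

-- `Summit.ValiantsHypothesis.ValiantsHypothesis.…` is the tree's single-conjunct layout (Sub = Summit).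
set_option linter.dupNamespace false

namespace Summit.ValiantsHypothesis.ValiantsHypothesis.Theorems

namespace PieceSigns

open Equiv ProductAction

variable {n : ℕ}

/-- **Invariant pieces are mapped to themselves up to units.**  If `θ · L` and `L` have the same associates, `P`
respects associates and `P (θ ℓ) ↔ P ℓ` for all `ℓ`, then `θ · {ℓ ∈ L : P ℓ}` and `{ℓ ∈ L : P ℓ}` have the same
associates. [folklore] -/
theorem map_mk_map_filter_eq_of_invariant
    (θ : MvPolynomial (Fin n × Fin n) ℂ ≃ₐ[ℂ] MvPolynomial (Fin n × Fin n) ℂ)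
    {L : Multiset (MvPolynomial (Fin n × Fin n) ℂ)} (hmk : (L.map θ).map Associates.mk = L.map Associates.mk)
    (P : MvPolynomial (Fin n × Fin n) ℂ → Prop) [DecidablePred P]
    (hP : ∀ p q : MvPolynomial (Fin n × Fin n) ℂ, Associated p q → (P p ↔ P q)) (hPθ : ∀ ℓ, P (θ ℓ) ↔ P ℓ) :
    ((L.filter P).map θ).map Associates.mk = (L.filter P).map Associates.mk := by
  have h1 := SupportBlocks.map_mk_filter_eq hP hmk
  have h2 : (L.map θ).filter P = (L.filter P).map θ := by
    rw [Multiset.filter_map]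
    congr 1
    exact Multiset.filter_congr fun ℓ _ => by simp only [Function.comp_apply, hPθ]
  rw [h2] at h1
  exact h1

/-- The same for the diagonal action `ren σ` (an algebra HOMOMORPHISM in the tree's typing). [folklore] -/
theorem map_mk_map_filter_eq_of_invariant_ren (σ : Perm (Fin n))
    {L : Multiset (MvPolynomial (Fin n × Fin n) ℂ)} (hmk : (L.map (ren σ)).map Associates.mk = L.map Associates.mk)
    (P : MvPolynomial (Fin n × Fin n) ℂ → Prop) [DecidablePred P]
    (hP : ∀ p q : MvPolynomial (Fin n × Fin n) ℂ, Associated p q → (P p ↔ P q)) (hPσ : ∀ ℓ, P (ren σ ℓ) ↔ P ℓ) :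
    ((L.filter P).map (ren σ)).map Associates.mk = (L.filter P).map Associates.mk := by
  have h1 := SupportBlocks.map_mk_filter_eq hP hmk
  have h2 : (L.map (ren σ)).filter P = (L.filter P).map (ren σ) := by
    rw [Multiset.filter_map]
    congr 1
    exact Multiset.filter_congr fun ℓ _ => by simp only [Function.comp_apply, hPσ]
  rw [h2] at h1
  exact h1

/-- **SIGN MULTIPLICATIVITY ON A PIECE.**  Let `S` be a multiset of nonzero polynomials mapped to itself up to units
by the pure row transposition `ρ = vact rowHom (x y)`, by the pure column transposition `κ = vact colHom (x y)` and
by the diagonal transposition `δ = ren (x y)`.  Then the number of members negated by `δ` has the parity of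
(number negated by `ρ`) + (number negated by `κ`):  `δ Π S = ρ (κ Π S)` and each side is `±Π S` with the sign given
by the sign count. [folklore] -/
theorem even_diag_iff_even_row_add_col (S : Multiset (MvPolynomial (Fin n × Fin n) ℂ)) (hS0 : ∀ ℓ ∈ S, ℓ ≠ 0)
    {x y : Fin n}
    (hmk_row : (S.map (vact (K := ℂ) rowHom (swap x y))).map Associates.mk = S.map Associates.mk)
    (hmk_col : (S.map (vact (K := ℂ) colHom (swap x y))).map Associates.mk = S.map Associates.mk)
    (hmk_diag : (S.map (ren (swap x y))).map Associates.mk = S.map Associates.mk) :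
    Even (Multiset.card (S.filter fun ℓ => ren (swap x y) ℓ = -ℓ)) ↔
      Even (Multiset.card (S.filter fun ℓ => vact (K := ℂ) rowHom (swap x y) ℓ = -ℓ) +
            Multiset.card (S.filter fun ℓ => vact (K := ℂ) colHom (swap x y) ℓ = -ℓ)) := by
  have hP0 : S.prod ≠ 0 := Multiset.prod_ne_zero fun h0 => hS0 0 h0 rfl
  have hinv_row : ∀ p, vact (K := ℂ) rowHom (swap x y) (vact (K := ℂ) rowHom (swap x y) p) = p := fun p => by
    rw [← AlgEquiv.mul_apply, ← map_mul, swap_mul_self, map_one, AlgEquiv.one_apply]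
  have hinv_col : ∀ p, vact (K := ℂ) colHom (swap x y) (vact (K := ℂ) colHom (swap x y) p) = p := fun p => by
    rw [← AlgEquiv.mul_apply, ← map_mul, swap_mul_self, map_one, AlgEquiv.one_apply]
  have hrowP := ActionSignCount.prod_map_eq_neg_one_pow_mul (vact (K := ℂ) rowHom (swap x y)) hinv_row S hS0 hmk_row
  have hcolP := ActionSignCount.prod_map_eq_neg_one_pow_mul (vact (K := ℂ) colHom (swap x y)) hinv_col S hS0 hmk_col
  have hdiagP := SignCount.prod_map_ren_eq_neg_one_pow_mul (swap x y) (swap_mul_self x y) S hS0 hmk_diag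
  have hκ : vact (K := ℂ) colHom (swap x y) S.prod =
      (-1) ^ Multiset.card (S.filter fun ℓ => vact (K := ℂ) colHom (swap x y) ℓ = -ℓ) * S.prod := by
    rw [map_multiset_prod]; exact hcolP
  have hρ : vact (K := ℂ) rowHom (swap x y) S.prod =
      (-1) ^ Multiset.card (S.filter fun ℓ => vact (K := ℂ) rowHom (swap x y) ℓ = -ℓ) * S.prod := by
    rw [map_multiset_prod]; exact hrowP
  have hδ : ren (swap x y) S.prod = (-1) ^ Multiset.card (S.filter fun ℓ => ren (swap x y) ℓ = -ℓ) * S.prod := by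
    rw [map_multiset_prod]; exact hdiagP
  have key : ((-1 : MvPolynomial (Fin n × Fin n) ℂ)) ^ Multiset.card (S.filter fun ℓ => ren (swap x y) ℓ = -ℓ) *
        S.prod =
      (-1) ^ (Multiset.card (S.filter fun ℓ => vact (K := ℂ) colHom (swap x y) ℓ = -ℓ) +
          Multiset.card (S.filter fun ℓ => vact (K := ℂ) rowHom (swap x y) ℓ = -ℓ)) * S.prod := by
    rw [← hδ, ren_eq_row_col, hκ, map_mul, map_pow, map_neg, map_one, hρ, ← mul_assoc, ← pow_add]
  have := FibreSigns.even_iff_even_of_neg_one_pow_eq (mul_right_cancel₀ hP0 key)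
  rwa [add_comm] at this

/-- **SIGN MULTIPLICATIVITY ON AN INVARIANT PIECE OF A MATRIX-SYMMETRIC AFFINE PRODUCT.**  Let `f = a·ΠL ≠ 0`
(degree-one factors) be invariant under the pure row and the pure column actions, and let `P` be a predicate that
respects associates and is invariant under `ρ = vact rowHom (x y)` and `κ = vact colHom (x y)`.  Then on the piece
`S = {ℓ ∈ L : P ℓ}`: `#{δ-negated} ≡ #{ρ-negated} + #{κ-negated} (mod 2)`. [folklore] -/
theorem even_diag_piece {L : Multiset (MvPolynomial (Fin n × Fin n) ℂ)} {a : ℂ}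
    (hL1 : ∀ ℓ ∈ L, ℓ.totalDegree = 1) (hf0 : MvPolynomial.C a * L.prod ≠ 0)
    (hrow : ∀ σ : Perm (Fin n), vact (K := ℂ) rowHom σ (MvPolynomial.C a * L.prod) = MvPolynomial.C a * L.prod)
    (hcol : ∀ τ : Perm (Fin n), vact (K := ℂ) colHom τ (MvPolynomial.C a * L.prod) = MvPolynomial.C a * L.prod)
    (P : MvPolynomial (Fin n × Fin n) ℂ → Prop) [DecidablePred P]
    (hP : ∀ p q : MvPolynomial (Fin n × Fin n) ℂ, Associated p q → (P p ↔ P q)) {x y : Fin n}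
    (hProw : ∀ ℓ, P (vact (K := ℂ) rowHom (swap x y) ℓ) ↔ P ℓ)
    (hPcol : ∀ ℓ, P (vact (K := ℂ) colHom (swap x y) ℓ) ↔ P ℓ) :
    Even (Multiset.card ((L.filter P).filter fun ℓ => ren (swap x y) ℓ = -ℓ)) ↔
      Even (Multiset.card ((L.filter P).filter fun ℓ => vact (K := ℂ) rowHom (swap x y) ℓ = -ℓ) +
            Multiset.card ((L.filter P).filter fun ℓ => vact (K := ℂ) colHom (swap x y) ℓ = -ℓ)) := by
  have hfix : ∀ σ : Perm (Fin n), ren σ (MvPolynomial.C a * L.prod) = MvPolynomial.C a * L.prod := fun σ => by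
    rw [ren_eq_row_col, hcol, hrow]
  have hPdiag : ∀ ℓ, P (ren (swap x y) ℓ) ↔ P ℓ := fun ℓ => by rw [ren_eq_row_col, hProw, hPcol]
  exact even_diag_iff_even_row_add_col (L.filter P)
    (fun ℓ hℓ => AffineFactors.ne_zero_of_mem hf0 (Multiset.mem_of_mem_filter hℓ))
    (map_mk_map_filter_eq_of_invariant _ (ActionSignCount.map_mk_map_vact_eq rowHom hL1 hf0 hrow (swap x y)) P hP
      hProw)
    (map_mk_map_filter_eq_of_invariant _ (ActionSignCount.map_mk_map_vact_eq colHom hL1 hf0 hcol (swap x y)) P hP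
      hPcol)
    (map_mk_map_filter_eq_of_invariant_ren _ (SupportBlocks.map_mk_map_ren_eq hL1 hf0 hfix (swap x y)) P hP hPdiag)

end PieceSigns

end Summit.ValiantsHypothesis.ValiantsHypothesis.Theorems

end
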